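import Literature.AnabelianGeometry.SemiGraphs.DoubleIncidenceOfEssentialSide
import Literature.AnabelianGeometry.SemiGraphs.DoubleIncidenceLift
import Literature.AnabelianGeometry.SemiGraphs.PortOfGaloisDoubleIncidence
import HarnessLib

/-!
# PORT PRODUCTION (d), assembly: an edge-cell ESSENTIAL ON BOTH SIDES has a PORT
# ([SemiAnbd] Def. 2.2 (i) p. 23, proof of Cor. 2.7 (i) p. 30)

Mochizuki, *Semi-graphs of anabelioids*, Publ. RIMS **42** (2006), §2, proof of Cor. 2.7 (i) p. 30
("[as one verifies immediately] `ℋ′` injects into `𝒢′` as a subgraph") [cite: MochizukiSemiAnbd2006, Cor. 2.7(i) p.30].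
PROOF-ONLY (abc-iut cell, layer L3; FACT-LIST row F-1487, CLASS route, brick R6a PORT PRODUCTION (d),
file D3; seat abc-iut-f-161 gen 12; L3-lead ε50).  No definition, no instance, no named fact.

* `exists_isGalois_over_two` — two connected `Y₁, Y₂ → A` carrying edge-cells over ONE edge-cell of
  `𝔾_A` are dominated by one GALOIS `Y → Y₁`, `Y → Y₂` over `A` (a point of the pullback in the fibre
  functor through the edge; Mathlib `exists_hom_from_galois_of_fiber`);
* `port_of_essential` — **R6a**: an edge-cell `(e, Q)` of `𝔾_A` ESSENTIAL ON BOTH SIDES (D1's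
  hypothesis at each of the two branches of `e`, each in its own `LevelEdgesOfObject` frame) has a PORT:
  the `hport` clause of `covering_subgraphComponents_doubleCosets_of_connectedPorts` at `(e, Q)`
  (D1 on each side, one Galois level over both, D2 twice, then `port_of_isGalois_of_doubleIncidence`).

CLASS route only: F-1487 AS TYPED is not asserted; not here: R6c (localised tie), R7 (hair).  Nothing here
takes a side on [IUTchIII] Cor. 3.12.
-/

namespace Literature.AnabelianGeometry.SemiGraphs.SemiGraphOfAnabelioids.BObj

open CategoryTheory CategoryTheory.Limits CategoryTheory.PreGaloisCategory
open Literature.AnabelianGeometry.Anabelioids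

universe v₁ u₁ u

set_option backward.isDefEq.respectTransparency false -- `π₀Obj` coercions, as in `ComponentsReadBack.lean`

variable {𝒢 : SemiGraphOfAnabelioids.{v₁, u₁, u}}

/-- **One Galois level over two**: if connected `Y₁, Y₂ → A` carry edge-cells `ec₁`, `ec₂` over the same
edge-cell `(e, Q)` of `𝔾_A`, some Galois `Y` maps to both compatibly over `A` (the two cells give a point
of `Y₁ ×_A Y₂` in the fibre functor through `e`). [cite: MochizukiSemiAnbd2006, Def. 2.2(i) p.23] -/
theorem exists_isGalois_over_two [GaloisCategory 𝒢.BObj] (h𝒢 : 𝒢.IsConnected) {A Y₁ Y₂ : 𝒢.BObj}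
    (g₁ : Y₁ ⟶ A) (g₂ : Y₂ ⟶ A) (e : 𝒢.graph.Edge) (Q : π₀Obj (A.T e))
    (ec₁ : Y₁.fibreData.total.Edge) (ec₂ : Y₂.fibreData.total.Edge)
    (h₁ : (⟨ec₁.1, componentUnder (g₁.fT ec₁.1) (Y₁.eComp ec₁)⟩ : Σ e, π₀Obj (A.T e)) = ⟨e, Q⟩)
    (h₂ : (⟨ec₂.1, componentUnder (g₂.fT ec₂.1) (Y₂.eComp ec₂)⟩ : Σ e, π₀Obj (A.T e)) = ⟨e, Q⟩) :
    ∃ (Y : 𝒢.BObj) (_ : IsGalois Y) (u₁ : Y ⟶ Y₁) (u₂ : Y ⟶ Y₂), u₁ ≫ g₁ = u₂ ≫ g₂ := by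
  classical
  -- normal form of the two cells
  have hnf : ∀ (Y' : 𝒢.BObj) (g : Y' ⟶ A) (ec : Y'.fibreData.total.Edge),
      (⟨ec.1, componentUnder (g.fT ec.1) (Y'.eComp ec)⟩ : Σ e, π₀Obj (A.T e)) = ⟨e, Q⟩ →
      ∃ c : π₀Obj (Y'.T e), componentUnder (g.fT e) c = Q := by
    rintro Y' g ⟨e₁, c₁⟩ hP
    obtain ⟨he1, hc1⟩ := Sigma.mk.inj_iff.mp hP
    change e₁ = e at he1
    subst he1
    exact ⟨_, eq_of_heq hc1⟩
  obtain ⟨c₁, hc₁⟩ := hnf Y₁ g₁ ec₁ h₁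
  obtain ⟨c₂, hc₂⟩ := hnf Y₂ g₂ ec₂ h₂
  -- a common point over a point of `Q`, in the fibre functor through `e`
  let Fe := GaloisCategory.getFiberFunctor (𝒢.E e)
  haveI : FiberFunctor (𝒢.ρE e ⋙ Fe) := 𝒢.fiberFunctor_ρE h𝒢 e Fe
  haveI := Q.2; haveI := c₁.2; haveI := c₂.2
  obtain ⟨q⟩ := nonempty_fiber_of_isConnected Fe (Q.1 : 𝒢.E e)
  obtain ⟨k₁, hk₁⟩ := exists_factor_componentUnder (g₁.fT e) c₁
  obtain ⟨k₂, hk₂⟩ := exists_factor_componentUnder (g₂.fT e) c₂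
  obtain ⟨k₁, hk₁⟩ : ∃ k : (c₁.1 : 𝒢.E e) ⟶ (Q.1 : 𝒢.E e), k ≫ Q.1.arrow = c₁.1.arrow ≫ g₁.fT e := by
    rw [← hc₁]; exact ⟨k₁, hk₁⟩
  obtain ⟨k₂, hk₂⟩ : ∃ k : (c₂.1 : 𝒢.E e) ⟶ (Q.1 : 𝒢.E e), k ≫ Q.1.arrow = c₂.1.arrow ≫ g₂.fT e := by
    rw [← hc₂]; exact ⟨k₂, hk₂⟩
  obtain ⟨z₁, hz₁⟩ := surjective_of_nonempty_fiber_of_isConnected Fe k₁ q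
  obtain ⟨z₂, hz₂⟩ := surjective_of_nonempty_fiber_of_isConnected Fe k₂ q
  have hpt : (𝒢.ρE e ⋙ Fe).map g₁ (Fe.map c₁.1.arrow z₁) = (𝒢.ρE e ⋙ Fe).map g₂ (Fe.map c₂.1.arrow z₂) := by
    change Fe.map (g₁.fT e) (Fe.map c₁.1.arrow z₁) = Fe.map (g₂.fT e) (Fe.map c₂.1.arrow z₂)
    rw [← FintypeCat.comp_apply, ← Fe.map_comp, ← hk₁, ← FintypeCat.comp_apply, ← Fe.map_comp, ← hk₂,
      Fe.map_comp, Fe.map_comp, FintypeCat.comp_apply, FintypeCat.comp_apply, hz₁, hz₂]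
  obtain ⟨Y, f, y, hY, -⟩ := exists_hom_from_galois_of_fiber (𝒢.ρE e ⋙ Fe) (pullback g₁ g₂)
    ((fiberPullbackEquiv (𝒢.ρE e ⋙ Fe) g₁ g₂).symm ⟨(_, _), hpt⟩)
  exact ⟨Y, hY, f ≫ pullback.fst g₁ g₂, f ≫ pullback.snd g₁ g₂, by
    rw [Category.assoc, Category.assoc, pullback.condition]⟩

/-- **R6a — an edge-cell ESSENTIAL ON BOTH SIDES has a PORT** ([SemiAnbd] proof of Cor. 2.7 (i) p. 30, at
OUR typed carriers).  `𝒢` connected; `(e, Q)` an edge-cell of `𝔾_A`, `e = {b₀, b₁}`; on the `b₀`-side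
(frame `v₁, F₁, F_e, α₁`) a point `a₁` over `Q` at which the side is ESSENTIAL, on the `b₁`-side (frame
`v₂, F₂, F_e′, α₂`) a point `a₂` over the same cell at which that side is ESSENTIAL.  Then the PORT clause
of `covering_subgraphComponents_doubleCosets_of_connectedPorts` holds at `(e, Q)`: some Galois `Y → A`
carries a two-sided NON-SEPARATING branch-cell over `Q`. [cite: MochizukiSemiAnbd2006, Cor. 2.7(i) p.30] -/
theorem port_of_essential [GaloisCategory 𝒢.BObj] (h𝒢 : 𝒢.IsConnected) (A : 𝒢.BObj)
    {v₁ : 𝒢.graph.Vertex} (F₁ : 𝒢.V v₁ ⥤ FintypeCat.{v₁}) [FiberFunctor F₁] [FiberFunctor (𝒢.ρ v₁ ⋙ F₁)]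
    (b₀ : 𝒢.graph.Branch) (h₀ : 𝒢.graph.abuts b₀ = some v₁)
    (Fe : 𝒢.E (𝒢.graph.edgeOf b₀) ⥤ FintypeCat.{v₁}) [FiberFunctor Fe]
    (α₁ : (𝒢.pull b₀ v₁ h₀).pullback ⋙ Fe ≅ F₁) (Q : π₀Obj (A.T (𝒢.graph.edgeOf b₀)))
    (a₁ : F₁.obj (A.S v₁))
    (ha₁ : Fe.map (A.ψ b₀ v₁ h₀).hom (α₁.inv.app (A.S v₁) a₁) ∈ Set.range (Fe.map Q.1.arrow))
    (hess₀ : ∃ u : 𝒢.PiV v₁ F₁, u • a₁ = a₁ ∧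
      𝒢.piVToPi v₁ F₁ u ∉ (𝒢.branchSubgroup F₁ b₀ h₀ Fe α₁).map (𝒢.piVToPi v₁ F₁))
    {v₂ : 𝒢.graph.Vertex} (F₂ : 𝒢.V v₂ ⥤ FintypeCat.{v₁}) [FiberFunctor F₂] [FiberFunctor (𝒢.ρ v₂ ⋙ F₂)]
    (b₁ : 𝒢.graph.Branch) (hb : b₁ ≠ b₀) (h₁ : 𝒢.graph.abuts b₁ = some v₂)
    (Fe' : 𝒢.E (𝒢.graph.edgeOf b₁) ⥤ FintypeCat.{v₁}) [FiberFunctor Fe']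
    (α₂ : (𝒢.pull b₁ v₂ h₁).pullback ⋙ Fe' ≅ F₂) (Q₁ : π₀Obj (A.T (𝒢.graph.edgeOf b₁)))
    (hQ₁ : (⟨𝒢.graph.edgeOf b₁, Q₁⟩ : Σ e, π₀Obj (A.T e)) = ⟨𝒢.graph.edgeOf b₀, Q⟩)
    (a₂ : F₂.obj (A.S v₂))
    (ha₂ : Fe'.map (A.ψ b₁ v₂ h₁).hom (α₂.inv.app (A.S v₂) a₂) ∈ Set.range (Fe'.map Q₁.1.arrow))
    (hess₁ : ∃ u : 𝒢.PiV v₂ F₂, u • a₂ = a₂ ∧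
      𝒢.piVToPi v₂ F₂ u ∉ (𝒢.branchSubgroup F₂ b₁ h₁ Fe' α₂).map (𝒢.piVToPi v₂ F₂)) :
    ∃ (Y : 𝒢.BObj) (_ : PreGaloisCategory.IsConnected Y) (g : Y ⟶ A)
      (bc : Y.fibreData.total.Branch) (vc₀ vc₁ : Y.fibreData.total.Vertex)
      (bc₁ : Y.fibreData.total.Branch),
      Y.fibreData.total.abuts bc = some vc₀ ∧ Y.fibreData.total.abuts bc₁ = some vc₁ ∧
      bc₁ ≠ bc ∧ Y.fibreData.total.edgeOf bc₁ = Y.fibreData.total.edgeOf bc ∧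
      Relation.ReflTransGen
        (fun x y : Y.fibreData.total.Vertex => ∃ b b' : Y.fibreData.total.Branch,
          b ≠ bc ∧ b' ≠ bc ∧ Y.fibreData.total.edgeOf b = Y.fibreData.total.edgeOf b' ∧
            Y.fibreData.total.abuts b = some x ∧ Y.fibreData.total.abuts b' = some y) vc₀ vc₁ ∧
      ∃ (Q' : π₀Obj (A.T (𝒢.graph.edgeOf (Y.fibreData.proj.branchMap bc)))),
        (⟨𝒢.graph.edgeOf (Y.fibreData.proj.branchMap bc), Q'⟩ : Σ e, π₀Obj (A.T e)) =
          ⟨𝒢.graph.edgeOf b₀, Q⟩ ∧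
        ∃ k : ((Y.brComp bc).1 : 𝒢.E (𝒢.graph.edgeOf (Y.fibreData.proj.branchMap bc))) ⟶
            (Q'.1 : 𝒢.E (𝒢.graph.edgeOf (Y.fibreData.proj.branchMap bc))),
          k ≫ Q'.1.arrow = (Y.brComp bc).1.arrow ≫ g.fT (𝒢.graph.edgeOf (Y.fibreData.proj.branchMap bc)) := by
  classical
  obtain ⟨Y₁, hY₁, g₁, β₀, β₀', hβ₀, hne₀, ha₀, ha₀', hQ₀⟩ :=
    exists_isGalois_doubleIncidence_of_essential A F₁ b₀ h₀ Fe α₁ Q a₁ ha₁ hess₀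
  obtain ⟨Y₂, hY₂, g₂, β₁, β₁', hβ₁, hne₁, hb₁a, hb₁a', hQ₁'⟩ :=
    exists_isGalois_doubleIncidence_of_essential A F₂ b₁ h₁ Fe' α₂ Q₁ a₂ ha₂ hess₁
  haveI := hY₁; haveI := hY₂
  have hQ₁'' : ∀ γ ∈ [β₁, β₁'], (⟨𝒢.graph.edgeOf (Y₂.fibreData.proj.branchMap γ),
      componentUnder (g₂.fT (𝒢.graph.edgeOf (Y₂.fibreData.proj.branchMap γ))) (Y₂.brComp γ)⟩ :
        Σ e, π₀Obj (A.T e)) = ⟨𝒢.graph.edgeOf b₀, Q⟩ := fun γ hγ => (hQ₁' γ hγ).trans hQ₁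
  -- one Galois level over both
  obtain ⟨Y, hY, u₁, u₂, hu⟩ := exists_isGalois_over_two h𝒢 g₁ g₂ (𝒢.graph.edgeOf b₀) Q
    (Y₁.fibreData.total.edgeOf β₀) (Y₂.fibreData.total.edgeOf β₁) (hQ₀ β₀ (by simp)) (hQ₁'' β₁ (by simp))
  haveI := hY
  -- lift both double incidences (D2)
  obtain ⟨γ₀, γ₀', hγ₀, hneγ₀, haγ₀, haγ₀', hQγ₀⟩ := doubleIncidence_lift h𝒢 u₁ g₁ (𝒢.graph.edgeOf b₀) Q
    β₀ β₀' hne₀ ha₀ ha₀' hQ₀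
  obtain ⟨γ₁, γ₁', hγ₁, hneγ₁, haγ₁, haγ₁', hQγ₁⟩ := doubleIncidence_lift h𝒢 u₂ g₂ (𝒢.graph.edgeOf b₀) Q
    β₁ β₁' hne₁ hb₁a hb₁a' hQ₁''
  -- STAGE 1 (`port_of_isGalois_of_doubleIncidence`)
  refine port_of_isGalois_of_doubleIncidence h𝒢 A (𝒢.graph.edgeOf b₀) Q (u₁ ≫ g₁) γ₀ γ₀' γ₁ γ₁' ?_
    hneγ₀ hneγ₁ haγ₀ haγ₀' haγ₁ haγ₁' ?_
  · rw [hγ₀, hγ₁, hβ₀, hβ₁]; exact hb.symm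
  · intro β hβ
    simp only [List.mem_cons, List.mem_nil_iff, or_false] at hβ
    rcases hβ with rfl | rfl | rfl | rfl
    · exact hQγ₀ _ (by simp)
    · exact hQγ₀ _ (by simp)
    · rw [hu]; exact hQγ₁ _ (by simp)
    · rw [hu]; exact hQγ₁ _ (by simp)

end Literature.AnabelianGeometry.SemiGraphs.SemiGraphOfAnabelioids.BObj
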